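import Summits.ResolutionOfSingularities.ResolutionOfSingularities.Theorems.EquisingularLiftEquisingularLiftNatConormalChartDictionary
import Summits.ResolutionOfSingularities.ResolutionOfSingularities.Theorems.EquisingularLiftEquisingularLiftNatEmbeddedLiftTorsorTransitive
import Summits.ResolutionOfSingularities.ResolutionOfSingularities.Theorems.EquisingularLiftEquisingularLiftNatEmbeddedLiftTorsorLaws
import HarnessLib

/-!
# [OURS · L1 W4.5(b) · EL♮(3) · J1c (π) brick F5] The chart torsor: lifts on one affine chart form a torsor under the sections of the normal sheaf

Crux chain w45b (cell `res-hironaka`, slot W4.5(b)), child crux **EL♮(3)** = stmt-ResolutionOfSingularities-20148; J1 = `EmbeddedInfinitesimalLiftFact`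
(p596985), discharge programme J1c, brick **(π)** (patching engine, res-type-027 g17; object split STATUS 2026-08-28T05:26Z). OURS; NOT a statement of
H. Hironaka's 2017 manuscript; AI-written, gate-checked, weaker than expert review. No `sorry`; standard axioms. ONE definition (`IsDiffSec`, a `Prop`).
`--supports stmt-ResolutionOfSingularities-20148 --as helper`.

This is R. Hartshorne, *Deformation Theory* (2010), Thm. 6.2 (a) («the set of extensions … is a pseudotorsor under `H⁰(Y₀, 𝒩₀ ⊗ J)`») on ONE AFFINE
CHART, joining the ring-level bricks J1b-α/β (`liftDiff` p599860, `act` p600361, laws p600680, transitivity p601439) to the SHEAF `𝒩 = 𝓗om(ι^*𝓘, 𝒪_{Y₀})`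
through the conormal chart dictionary F4 (p608248). ABSTRACT CHART CURRENCY (so that the patching F6 instantiates it once with `A' := Γ(Wₙ₊₁, U)`):
* the base: a commutative ring `C'` with `𝔪 ⊆ C'`, `ε ∈ 𝔪`, `ann ε = 𝔪` (`hann`), `𝔪` nilpotent — J1's instance is `C' = O/𝔪ⁿ⁺²`, `ε = ϖⁿ⁺¹`;
* the chart: a `C'`-algebra `A'` (the chart ring of the ambient thickening) with a SURJECTION `π : A' ↠ Γ(W₀, V)` onto the ring of an affine open `V`
  of the special fibre `W₀`, `ker π = 𝔪A'`; the closed immersion `ι : Y₀ ⟶ W₀` with ideal `𝓘(V)` generated by a weakly regular sequence (lci chart);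
* a LIFT on the chart: an ideal `J ≤ A'` with `A'/J` flat over `C'` and `π(J) = 𝓘(V)`; two lifts `J, J'` are COMPARABLE when `J ≤ J' + (ε)` and
  `J' ≤ J + (ε)` (same reduction modulo `ε`).
* `IsDiffSec ι ε π J J' μ` — **the section `μ ∈ Γ(ι⁻¹V, 𝒩)` is the difference of the lifts `J, J'`**, in representative form: whenever `m ∈ Γ(V, 𝓘)` reads
  `π j` (`j ∈ J`) and `j − εy ∈ J'`, then `μ(η m) = ι♯(π y)`. (The class `[y]` is Hartshorne's `φ(x)`, `liftDiff`; `η m` the conormal class of `m`.)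

RESULTS (hypotheses as in the statements):
* `exists_isDiffSec`, `isDiffSec_unique` — every comparable pair of lifts HAS exactly one difference section (F4 `exists_normalSection_of_semilinear`,
  well-definedness `sub_mem_sup_of_lifts` from the flatness of both quotients);
* `isDiffSec_self_zero`, `isDiffSec_add`, `isDiffSec_neg` — cocycle laws (`0` for `J = J'`, additivity over a third lift, antisymmetry);
* `le_of_isDiffSec_zero`, `eq_of_isDiffSec_zero` — **detection**: difference section `0` ⟹ the lifts coincide;
* (sequel file …NatChartLiftTorsorAction:) `exists_lift_isDiffSec` — action/transitivity: every section `μ` IS the difference section of `J` and some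
  lift `J''`; `isDiffSec_restrict` — compatibility with restriction to a smaller chart (`A' → A₁` over `V₁ ⊆ V`).

References (method / index only): R. Hartshorne, *Deformation Theory* (2010), Thm. 6.2 (a) and its proof pp. 47–48; The Stacks Project, Tag 00HK.
-/

set_option linter.dupNamespace false -- mandated namespace `Summit.<Summit>.<Problem>` of this single-conjunct summit

noncomputable section

open CategoryTheory CategoryTheory.Limits AlgebraicGeometry Opposite TopologicalSpace
open Literature.AlgebraicGeometry.Modules Literature.AlgebraicGeometry.Deformation Literature.AlgebraicGeometry.HodgeTheory

namespace Summit.ResolutionOfSingularities.ResolutionOfSingularities.Cruxes.EquisingularLiftNat.Sections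

variable {C' : Type} [CommRing C'] {𝔪 : Ideal C'} {ε : C'}
variable {W₀ Y₀ : Scheme.{0}} (ι : Y₀ ⟶ W₀)
variable {A' : Type} [CommRing A'] [Algebra C' A']

/-- **`IsDiffSec ι ε π J J' μ` — `μ` is the difference section of the chart lifts `J, J'`** (Hartshorne 2010, proof of Thm. 6.2 (a): the class
`φ(x) = [x'' − x']`), in representative form: for every ideal-module section `m` over `V` reading `π j` with `j ∈ J`, and every `y` with `j − εy ∈ J'`,
the value of `μ` on the conormal class `η m` is `ι♯(π y)`. [OURS · predicate of the (π) engine; NOT a statement of a source] -/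
def IsDiffSec (ε : C') {V : W₀.Opens} (π : A' →+* Γ(W₀, V)) (J J' : Ideal A')
    (μ : (conormalSheaf ι).over (ι ⁻¹ᵁ V) ⟶ (unitModule Y₀).over (ι ⁻¹ᵁ V)) : Prop :=
  ∀ (m : Γ(idealModule ι, V)) (j y : A'), j ∈ J → toRing (idealModuleι ι) V m = π j → j - algebraMap C' A' ε * y ∈ J' →
    appLE μ (𝟙 _) (unitSectionLE ι (idealModule ι) (le_refl (ι ⁻¹ᵁ V)) m) = ι.app V (π y)

/-! ## Ring-level bookkeeping for comparable lifts -/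

section Ring

omit [Algebra C' A'] in
/-- `appLE` commutes with negation of morphisms. [folklore] -/
theorem appLE_neg {X : Scheme.{0}} {E M : X.Modules} {U W : X.Opens} (φ : E.over U ⟶ M.over U) (k : W ⟶ U) (s : Γ(E, W)) :
    appLE (-φ) k s = -appLE φ k s := by
  have h : appLE (-φ + φ) k s = 0 := by rw [neg_add_cancel, appLE_zero]
  rw [appLE_add] at h
  exact eq_neg_of_add_eq_zero_left h

/-- `𝔪A'·J ⊆ J'` for comparable lifts (`J ≤ J' + (ε)`, `ε𝔪 = 0`). [folklore] -/
theorem map_mul_le_of_le_sup_span (hann : ∀ c : C', ε * c = 0 ↔ c ∈ 𝔪) {J J' : Ideal A'}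
    (hI : J ≤ J' ⊔ Ideal.span {algebraMap C' A' ε}) : 𝔪.map (algebraMap C' A') * J ≤ J' := by
  rw [Ideal.mul_le]
  intro r hr s hs
  obtain ⟨a, ha, b, hb, rfl⟩ := Submodule.mem_sup.mp (hI hs)
  obtain ⟨w, rfl⟩ := Ideal.mem_span_singleton'.mp hb
  rw [mul_add, show r * (w * algebraMap C' A' ε) = w * (algebraMap C' A' ε * r) by ring, algebraMap_mul_eq_zero_of_mem_map hann hr,
    mul_zero, add_zero]
  exact J'.mul_mem_left r ha

/-- **Well-definedness of the difference class** (both quotients flat): if `j, j₁ ∈ J` differ by an element of `𝔪A'` and `j − εy, j₁ − εy₁ ∈ J'`, then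
`y − y₁ ∈ J' + 𝔪A'` (`J ∩ 𝔪A' = 𝔪J ⊆ J'`, then `ker(ε·) = 𝔪` on the flat `A'/J'`). [cite: Hartshorne2010, Thm. 6.2 (a) (proof: «`φ` is well-defined»)] -/
theorem sub_mem_sup_of_lifts (hann : ∀ c : C', ε * c = 0 ↔ c ∈ 𝔪) (J J' : Ideal A') [Module.Flat C' (A' ⧸ J)] [Module.Flat C' (A' ⧸ J')]
    (hI : J ≤ J' ⊔ Ideal.span {algebraMap C' A' ε}) {j j₁ y y₁ : A'} (hj : j ∈ J) (hj₁ : j₁ ∈ J) (hd : j - j₁ ∈ 𝔪.map (algebraMap C' A'))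
    (hy : j - algebraMap C' A' ε * y ∈ J') (hy₁ : j₁ - algebraMap C' A' ε * y₁ ∈ J') : y - y₁ ∈ J' ⊔ 𝔪.map (algebraMap C' A') := by
  have hJJ' : j - j₁ ∈ J' :=
    map_mul_le_of_le_sup_span hann hI (mem_smul_of_mem_inf_map_of_flat 𝔪 J (J.sub_mem hj hj₁) hd)
  have hε : algebraMap C' A' ε * (y - y₁) ∈ J' := by
    have : algebraMap C' A' ε * (y - y₁) = (j - j₁) - (j - algebraMap C' A' ε * y) + (j₁ - algebraMap C' A' ε * y₁) := by ring
    rw [this]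
    exact J'.add_mem (J'.sub_mem hJJ' hy) hy₁
  exact (smul_mk_eq_zero_iff_mem_sup_of_flat hann J' (y - y₁)).mp hε

variable {V : W₀.affineOpens} (π : A' →+* Γ(W₀, (V : W₀.Opens)))

/-- `π` kills `εA'` when `ε ∈ 𝔪` and `ker π = 𝔪A'`. [folklore] -/
theorem apply_algebraMap_mul_eq_zero (hεm : ε ∈ 𝔪) (hkerπ : RingHom.ker π = 𝔪.map (algebraMap C' A')) (y : A') :
    π (algebraMap C' A' ε * y) = 0 := by
  rw [map_mul, show π (algebraMap C' A' ε) = 0 from (RingHom.mem_ker).mp (hkerπ ▸ Ideal.mem_map_of_mem _ hεm), zero_mul]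

/-- Comparable lifts have the same image under `π`: `J ≤ J' + (ε) ⟹ π(J) ≤ π(J')`. [folklore] -/
theorem map_le_map_of_le_sup_span (hεm : ε ∈ 𝔪) (hkerπ : RingHom.ker π = 𝔪.map (algebraMap C' A')) {J J' : Ideal A'}
    (hI : J ≤ J' ⊔ Ideal.span {algebraMap C' A' ε}) : J.map π ≤ J'.map π := by
  refine (Ideal.map_mono hI).trans ?_
  rw [Ideal.map_sup, Ideal.map_span, Set.image_singleton,
    show π (algebraMap C' A' ε) = 0 from (RingHom.mem_ker).mp (hkerπ ▸ Ideal.mem_map_of_mem _ hεm), Ideal.span_singleton_zero, sup_bot_eq]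

variable [IsClosedImmersion ι]

/-- `ι♯ ∘ π` kills `J + 𝔪A'` when `π(J) = 𝓘(V)`. [folklore] -/
theorem app_apply_eq_zero_of_mem_sup (hkerπ : RingHom.ker π = 𝔪.map (algebraMap C' A')) {J : Ideal A'} (hJ : J.map π ≤ ι.ker.ideal V) {z : A'}
    (hz : z ∈ J ⊔ 𝔪.map (algebraMap C' A')) : ι.app (V : W₀.Opens) (π z) = 0 := by
  obtain ⟨a, ha, b, hb, rfl⟩ := Submodule.mem_sup.mp hz
  have hb0 : π b = 0 := (RingHom.mem_ker).mp (hkerπ ▸ hb)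
  have ha0 : π a ∈ RingHom.ker (ι.app (V : W₀.Opens)).hom := by
    rw [← Scheme.Hom.ker_apply ι V]
    exact hJ (Ideal.mem_map_of_mem _ ha)
  rw [map_add, hb0, add_zero]
  exact ha0

/-- `ker (ι♯ ∘ π) = J + 𝔪A'` when `π` is surjective with kernel `𝔪A'` and `π(J) = 𝓘(V)`. [folklore] -/
theorem ker_app_comp_eq_sup (hπ : Function.Surjective π) (hkerπ : RingHom.ker π = 𝔪.map (algebraMap C' A')) {J : Ideal A'}
    (hJ : J.map π = ι.ker.ideal V) : RingHom.ker ((ι.app (V : W₀.Opens)).hom.comp π) = J ⊔ 𝔪.map (algebraMap C' A') := by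
  rw [← RingHom.comap_ker, ← Scheme.Hom.ker_apply ι V, ← hJ, Ideal.comap_map_of_surjective π hπ, ← RingHom.ker_eq_comap_bot, hkerπ]

/-- `ι♯ ∘ π` is surjective (`π` surjective, `ι` a closed immersion, `V` affine). [folklore] -/
theorem app_comp_surjective (hπ : Function.Surjective π) : Function.Surjective ((ι.app (V : W₀.Opens)).hom.comp π) :=
  (ι.app_surjective (V : W₀.Opens) V.2).comp hπ

/-- Elements of `J` read as sections of `𝓘` over `V` when `π(J) = 𝓘(V)`. [folklore] -/
theorem exists_toRing_eq_apply {J : Ideal A'} (hJ : J.map π ≤ ι.ker.ideal V) {j : A'} (hj : j ∈ J) :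
    ∃ m : Γ(idealModule ι, (V : W₀.Opens)), toRing (idealModuleι ι) (V : W₀.Opens) m = π j :=
  exists_toRing_eq_of_mem_ker_ideal ι V (hJ (Ideal.mem_map_of_mem _ hj))

/-- Sections of `𝓘` over `V` read as `π j`, `j ∈ J`, when `π(J) = 𝓘(V)` and `π` is surjective. [folklore] -/
theorem exists_mem_apply_eq_toRing (hπ : Function.Surjective π) {J : Ideal A'} (hJ : J.map π = ι.ker.ideal V)
    (m : Γ(idealModule ι, (V : W₀.Opens))) : ∃ j ∈ J, π j = toRing (idealModuleι ι) (V : W₀.Opens) m := by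
  have hm : toRing (idealModuleι ι) (V : W₀.Opens) m ∈ J.map π := hJ ▸ toRing_mem_ker_ideal ι V m
  obtain ⟨j, hj, hjm⟩ := (Ideal.mem_map_iff_of_surjective π hπ).mp hm
  exact ⟨j, hj, hjm⟩

end Ring

/-! ## Existence and uniqueness of the difference section -/

section Exists

variable [IsClosedImmersion ι] [IsLocallyNoetherian W₀]
variable (hann : ∀ c : C', ε * c = 0 ↔ c ∈ 𝔪) (hεm : ε ∈ 𝔪)
variable {V : W₀.affineOpens} {n : ℕ} (x : Fin n → Γ(W₀, (V : W₀.Opens)))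
  (hreg : RingTheory.Sequence.IsWeaklyRegular Γ(W₀, (V : W₀.Opens)) (List.ofFn x)) (hI₀ : Ideal.span (Set.range x) = ι.ker.ideal V)
  (π : A' →+* Γ(W₀, (V : W₀.Opens))) (hπ : Function.Surjective π) (hkerπ : RingHom.ker π = 𝔪.map (algebraMap C' A'))

include hann hreg hI₀ hπ hkerπ in
/-- **Existence of the difference section** of two comparable lifts with flat quotients (Hartshorne 2010, Thm. 6.2 (a), affine case: the class `φ` is
a well-defined `A`-linear map `I → J ⊗ B`, i.e. a section of `𝒩₀` on the affine piece; here through F4's dictionary).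
[cite: Hartshorne2010, Thm. 6.2 (a) (proof, affine case)] -/
theorem exists_isDiffSec (J J' : Ideal A') [Module.Flat C' (A' ⧸ J)] [Module.Flat C' (A' ⧸ J')] (hJ : J.map π = ι.ker.ideal V)
    (hJ' : J'.map π = ι.ker.ideal V) (hI : J ≤ J' ⊔ Ideal.span {algebraMap C' A' ε}) :
    ∃ μ : (conormalSheaf ι).over (ι ⁻¹ᵁ (V : W₀.Opens)) ⟶ (unitModule Y₀).over (ι ⁻¹ᵁ (V : W₀.Opens)), IsDiffSec ι ε π J J' μ := by
  classical
  -- choices: `j m ∈ J` reading `m`, and `y m` with `j m - ε y m ∈ J'`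
  have hjex : ∀ m : Γ(idealModule ι, (V : W₀.Opens)), ∃ j ∈ J, π j = toRing (idealModuleι ι) (V : W₀.Opens) m :=
    exists_mem_apply_eq_toRing ι π hπ hJ
  choose jm hjm hπjm using hjex
  have hyex : ∀ m : Γ(idealModule ι, (V : W₀.Opens)), ∃ y : A', jm m - algebraMap C' A' ε * y ∈ J' :=
    fun m => exists_sub_mul_mem J J' hI ⟨jm m, hjm m⟩
  choose ym hym using hyex
  -- the key: any representatives give the same value
  have key : ∀ (m : Γ(idealModule ι, (V : W₀.Opens))) (j y : A'), j ∈ J → toRing (idealModuleι ι) (V : W₀.Opens) m = π j →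
      j - algebraMap C' A' ε * y ∈ J' → ι.app (V : W₀.Opens) (π y) = ι.app (V : W₀.Opens) (π (ym m)) := by
    intro m j y hj hm hy
    have hd : j - jm m ∈ 𝔪.map (algebraMap C' A') := by
      rw [← hkerπ, RingHom.mem_ker, map_sub, ← hm, hπjm, sub_self]
    have h := sub_mem_sup_of_lifts hann J J' hI hj (hjm m) hd hy (hym m)
    have h0 := app_apply_eq_zero_of_mem_sup ι π hkerπ hJ'.le h
    rwa [map_sub, map_sub, sub_eq_zero] at h0
  have hadd : ∀ m m' : Γ(idealModule ι, (V : W₀.Opens)),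
      ι.app (V : W₀.Opens) (π (ym (m + m'))) = ι.app (V : W₀.Opens) (π (ym m)) + ι.app (V : W₀.Opens) (π (ym m')) := by
    intro m m'
    -- `j m + j m'` reads `m + m'`
    have h := key (m + m') (jm m + jm m') (ym m + ym m') (J.add_mem (hjm m) (hjm m'))
      (by rw [toRing_add, map_add, hπjm, hπjm]) (by
        have : jm m + jm m' - algebraMap C' A' ε * (ym m + ym m') =
          (jm m - algebraMap C' A' ε * ym m) + (jm m' - algebraMap C' A' ε * ym m') := by ring
        rw [this]; exact J'.add_mem (hym m) (hym m'))
    rw [← h, map_add, map_add]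
  have hsmul : ∀ (a : Γ(W₀, (V : W₀.Opens))) (m : Γ(idealModule ι, (V : W₀.Opens))),
      ι.app (V : W₀.Opens) (π (ym (a • m))) = ι.app (V : W₀.Opens) a * ι.app (V : W₀.Opens) (π (ym m)) := by
    intro a m
    -- `ã · j m` reads `a • m` for a lift `ã` of `a`
    obtain ⟨a', rfl⟩ := hπ a
    have h := key (π a' • m) (a' * jm m) (a' * ym m) (J.mul_mem_left a' (hjm m))
      (by rw [toRing_smul, map_mul, hπjm]) (by
        have : a' * jm m - algebraMap C' A' ε * (a' * ym m) = a' * (jm m - algebraMap C' A' ε * ym m) := by ring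
        rw [this]; exact J'.mul_mem_left a' (hym m))
    rw [← h, map_mul, map_mul]
  obtain ⟨μ, hμ⟩ := exists_normalSection_of_semilinear ι V x hreg hI₀ (fun m => ι.app (V : W₀.Opens) (π (ym m))) hadd hsmul
  refine ⟨μ, fun m j y hj hm hy => ?_⟩
  rw [hμ m]
  exact (key m j y hj hm hy).symm

include hI₀ hreg hπ in
/-- **Uniqueness of the difference section** (F4 `normalSection_ext`: a section of `𝒩` over an lci chart is determined by its values on the conormal
classes). [folklore] -/
theorem isDiffSec_unique {J J' : Ideal A'} (hJ : J.map π = ι.ker.ideal V) (hI : J ≤ J' ⊔ Ideal.span {algebraMap C' A' ε})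
    {μ μ' : (conormalSheaf ι).over (ι ⁻¹ᵁ (V : W₀.Opens)) ⟶ (unitModule Y₀).over (ι ⁻¹ᵁ (V : W₀.Opens))}
    (hμ : IsDiffSec ι ε π J J' μ) (hμ' : IsDiffSec ι ε π J J' μ') : μ = μ' := by
  refine normalSection_ext ι V x hreg hI₀ fun m => ?_
  obtain ⟨j, hj, hjm⟩ := exists_mem_apply_eq_toRing ι π hπ hJ m
  obtain ⟨y, hy⟩ := exists_sub_mul_mem J J' hI ⟨j, hj⟩
  rw [hμ m j y hj hjm.symm hy, hμ' m j y hj hjm.symm hy]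

end Exists

/-! ## The cocycle laws -/

section Laws

variable [IsClosedImmersion ι]
variable (hann : ∀ c : C', ε * c = 0 ↔ c ∈ 𝔪) (hεm : ε ∈ 𝔪)
variable {V : W₀.affineOpens} (π : A' →+* Γ(W₀, (V : W₀.Opens))) (hπ : Function.Surjective π)
  (hkerπ : RingHom.ker π = 𝔪.map (algebraMap C' A'))

include hann hkerπ in
/-- **`0` is the difference section of `J` with itself** (`A'/J` flat: `εy ∈ J ⟹ y ∈ J + 𝔪A'`). [folklore] -/
theorem isDiffSec_self_zero (J : Ideal A') [Module.Flat C' (A' ⧸ J)] (hJ : J.map π = ι.ker.ideal V) : IsDiffSec ι ε π J J 0 := by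
  intro m j y hj _ hy
  rw [appLE_zero]
  have hεy : algebraMap C' A' ε * y ∈ J := by
    have := J.sub_mem hj hy
    rwa [sub_sub_cancel] at this
  exact (app_apply_eq_zero_of_mem_sup ι π hkerπ hJ.le ((smul_mk_eq_zero_iff_mem_sup_of_flat hann J y).mp hεy)).symm

include hann hεm hkerπ in
/-- **Additivity over a third lift**: `φ_{J,J''} = φ_{J,J'} + φ_{J',J''}` for comparable lifts with flat quotients (Hartshorne's «the operation is an
action»). [cite: Hartshorne2010, Thm. 6.2 (a)] -/
theorem isDiffSec_add (J J' J'' : Ideal A') [Module.Flat C' (A' ⧸ J)] [Module.Flat C' (A' ⧸ J'')]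
    (hJ'' : J''.map π = ι.ker.ideal V) (hI₁₂ : J ≤ J' ⊔ Ideal.span {algebraMap C' A' ε}) (hI₂₃ : J' ≤ J'' ⊔ Ideal.span {algebraMap C' A' ε})
    (hI₁₃ : J ≤ J'' ⊔ Ideal.span {algebraMap C' A' ε})
    {μ μ' : (conormalSheaf ι).over (ι ⁻¹ᵁ (V : W₀.Opens)) ⟶ (unitModule Y₀).over (ι ⁻¹ᵁ (V : W₀.Opens))}
    (hμ : IsDiffSec ι ε π J J' μ) (hμ' : IsDiffSec ι ε π J' J'' μ') : IsDiffSec ι ε π J J'' (μ + μ') := by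
  intro m j y hj hm hy
  obtain ⟨y₁, hy₁⟩ := exists_sub_mul_mem J J' hI₁₂ ⟨j, hj⟩
  have hj₁ : j - algebraMap C' A' ε * y₁ ∈ J' := hy₁
  have hπj₁ : π (j - algebraMap C' A' ε * y₁) = π j := by
    rw [map_sub, apply_algebraMap_mul_eq_zero π hεm hkerπ, sub_zero]
  obtain ⟨y₂, hy₂⟩ := exists_sub_mul_mem J' J'' hI₂₃ ⟨j - algebraMap C' A' ε * y₁, hj₁⟩
  have hy₁₂ : j - algebraMap C' A' ε * (y₁ + y₂) ∈ J'' := by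
    have : j - algebraMap C' A' ε * (y₁ + y₂) = (j - algebraMap C' A' ε * y₁) - algebraMap C' A' ε * y₂ := by ring
    rw [this]; exact hy₂
  have h1 := hμ m j y₁ hj hm hj₁
  have h2 := hμ' m (j - algebraMap C' A' ε * y₁) y₂ hj₁ (hm.trans hπj₁.symm) hy₂
  -- `y` and `y₁ + y₂` give the same class
  have hd : y - (y₁ + y₂) ∈ J'' ⊔ 𝔪.map (algebraMap C' A') :=
    sub_mem_sup_of_lifts hann J J'' hI₁₃ hj hj (by rw [sub_self]; exact Submodule.zero_mem _) hy hy₁₂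
  have h0 := app_apply_eq_zero_of_mem_sup ι π hkerπ hJ''.le hd
  rw [map_sub, map_sub, sub_eq_zero, map_add, map_add] at h0
  rw [appLE_add, h1, h2, h0]
  rfl

omit [IsClosedImmersion ι] in
include hεm hkerπ in
/-- **Antisymmetry**: `φ_{J',J} = −φ_{J,J'}`. [folklore] -/
theorem isDiffSec_neg (J J' : Ideal A')
    {μ : (conormalSheaf ι).over (ι ⁻¹ᵁ (V : W₀.Opens)) ⟶ (unitModule Y₀).over (ι ⁻¹ᵁ (V : W₀.Opens))}
    (hμ : IsDiffSec ι ε π J J' μ) : IsDiffSec ι ε π J' J (-μ) := by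
  intro m j' y hj' hm hy
  -- `j := j' - εy ∈ J` reads the same section, and `j - ε(-y) = j'`
  have hπj : π (j' - algebraMap C' A' ε * y) = π j' := by
    rw [map_sub, apply_algebraMap_mul_eq_zero π hεm hkerπ, sub_zero]
  have h := hμ m (j' - algebraMap C' A' ε * y) (-y) hy (hm.trans hπj.symm) (by
    have : j' - algebraMap C' A' ε * y - algebraMap C' A' ε * -y = j' := by ring
    rw [this]; exact hj')
  rw [appLE_neg, h, map_neg, map_neg]
  exact neg_neg _

include hann hkerπ hπ in
/-- **Detection, inclusion form**: if `0` is a difference section of the comparable lifts `J, J'` (`π(J) = π(J') = 𝓘(V)`), then `J ≤ J'`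
(`φ = 0 ⟹ y ∈ J' + 𝔪A' ⟹ εy ∈ J' ⟹ j ∈ J'`). [cite: Hartshorne2010, Thm. 6.2 (a) («pseudotorsor»)] -/
theorem le_of_isDiffSec_zero (J J' : Ideal A') (hJ : J.map π = ι.ker.ideal V) (hJ' : J'.map π = ι.ker.ideal V)
    (hI : J ≤ J' ⊔ Ideal.span {algebraMap C' A' ε}) (h0 : IsDiffSec ι ε π J J' 0) : J ≤ J' := by
  intro j hj
  obtain ⟨m, hm⟩ := exists_toRing_eq_apply ι π hJ.le hj
  obtain ⟨y, hy⟩ := exists_sub_mul_mem J J' hI ⟨j, hj⟩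
  have h := h0 m j y hj hm hy
  rw [appLE_zero] at h
  -- `y ∈ ker (ι♯ ∘ π) = J' + 𝔪A'`
  have hy' : y ∈ J' ⊔ 𝔪.map (algebraMap C' A') := by
    rw [← ker_app_comp_eq_sup ι π hπ hkerπ hJ', RingHom.mem_ker, RingHom.comp_apply]
    exact h.symm
  obtain ⟨a, ha, b, hb, rfl⟩ := Submodule.mem_sup.mp hy'
  have hεy : algebraMap C' A' ε * (a + b) ∈ J' := by
    rw [mul_add, algebraMap_mul_eq_zero_of_mem_map hann hb, add_zero]
    exact J'.mul_mem_left _ ha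
  have := J'.add_mem hy hεy
  rwa [sub_add_cancel] at this

include hann hεm hkerπ hπ in
/-- **Detection**: comparable lifts (flat quotient, `𝔪` nilpotent) with difference section `0` are EQUAL. [cite: Hartshorne2010, Thm. 6.2 (a) («pseudotorsor»)] -/
theorem eq_of_isDiffSec_zero (hnil : IsNilpotent 𝔪) (J J' : Ideal A') [Module.Flat C' (A' ⧸ J')] (hJ : J.map π = ι.ker.ideal V)
    (hJ' : J'.map π = ι.ker.ideal V) (hI : J ≤ J' ⊔ Ideal.span {algebraMap C' A' ε}) (hI' : J' ≤ J ⊔ Ideal.span {algebraMap C' A' ε})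
    (h0 : IsDiffSec ι ε π J J' 0) : J = J' :=
  eq_of_le_of_flat hann hεm hnil J J' (le_of_isDiffSec_zero ι hann π hπ hkerπ J J' hJ hJ' hI h0) hI'

end Laws

end Summit.ResolutionOfSingularities.ResolutionOfSingularities.Cruxes.EquisingularLiftNat.Sections

end
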